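import Summits.ABC.ABC.Theorems.CongruentialReceptacleTameLocalReceptacleFamilyCounts
import Literature.NumberTheory.Sieve.SmoothParityTernary

/-!
# Crux `TameLocalReceptacle` (stmt-ABC-14354), line `grh-friable-cell-resolution`:
# `#FAfam` dominates the Bonferroni combination of parity ternary counts

Registered stub `stub_cardFA_ge_bonferroni` of the checked skeleton
`Cruxes/TameLocalReceptacle/Lines/grh_friable_cell_resolution.lean` (lead `prover-line-stmt-ABC-14354-a1-0`, wave 7).
With `X = 2^N M`, `W(X₁, X₂, X₃) := parityTernarySum y 1 (2^N) 1 X₁ X₂ X₃ c₁ c₂ c₃` (the profile-weighted count of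
`y`-friable solutions of `2^N m + b = c`, `m ≤ X₁` odd, `b ≤ X₂` odd, `c ≤ X₃` free) and REAL profiles
`0 ≤ p₁, p₂ ≤ 1_{(1/2,1]}`, `0 ≤ p₃ ≤ 1`:

`Re W(2M, 2X, 4X) − Σ_{3 ≤ p ≤ y prime} Re W(2M/p, 2X/p, 4X/p) ≤ #FAfam N M y`.

Proof (pure `Finset` bookkeeping + a Bonferroni inequality):
* realness collapses `W` to a real double sum over `(m, b)` of nonnegative weights
  `w(m,b) = p₁(m/X₁) p₂(b/X₂) p₃((2^N m + b)/X₃) · [2^N m + b ∈ S(X₃, y)]` (`re_parityTernarySum_eq`);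
* the substitution `m = p m₁`, `b = p b₁` embeds the `p`-sublattice part of `W` into `W_p`
  (`sum_filter_dvd_le`: an INEQUALITY suffices, so only `0 < p` is used);
* pointwise, `1 − Σ_p [p ∣ m][p ∣ b] ≤ [gcd(m, b) = 1]` for `m` odd `y`-friable (a common prime factor is odd
  and `≤ y`), and `w(m, b) ≤ 1_{(m, b) ∈ PairsA}` on coprime pairs by the profile supports
  (`weight_mul_bonferroni_le`);
* `#FAfam = #PairsA` (`card_FAfam`).
-/

-- `Summit.<Summit>.<Problem>` is the mandated summit-side namespace (CONVENTIONS §2); for the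
-- single-conjunct summit `ABC` the two coincide, so the duplicate `ABC.ABC` is deliberate.
set_option linter.dupNamespace false

noncomputable section

namespace Summit.ABC.ABC.Theorems.TameLocalReceptacle

open Finset Literature.NumberTheory.Sieve.SmoothArcs

namespace BonferroniFABook

/-! ### Generic bookkeeping -/

/-- Transport of a sum along an injection covering the index set, with a pointwise bound. [folklore] -/
theorem sum_le_sum_of_subset_image {α β : Type*} [DecidableEq α] {s : Finset α} {t : Finset β}
    {G : α → ℝ} {G' : β → ℝ} (ι : β → α) (hι : Function.Injective ι) (hs : s ⊆ t.image ι)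
    (hG : ∀ x, 0 ≤ G x) (hle : ∀ z ∈ t, G (ι z) ≤ G' z) : ∑ x ∈ s, G x ≤ ∑ z ∈ t, G' z :=
  calc ∑ x ∈ s, G x ≤ ∑ x ∈ t.image ι, G x := Finset.sum_le_sum_of_subset_of_nonneg hs fun x _ _ => hG x
    _ = ∑ z ∈ t, G (ι z) := Finset.sum_image fun _ _ _ _ h => hι h
    _ ≤ ∑ z ∈ t, G' z := Finset.sum_le_sum hle

/-- BONFERRONI ASSEMBLY: if each `W p` dominates the `Q p`-part of `Σ G` and pointwise
`G x · (1 − Σ_p [Q p x]) ≤ [x ∈ T]`, then `Σ G − Σ_p W p ≤ #T`. [folklore] -/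
theorem sub_sum_le_card {α : Type*} [DecidableEq α] (s : Finset α) (P : Finset ℕ) (G : α → ℝ)
    (W : ℕ → ℝ) (Q : ℕ → α → Prop) [∀ p x, Decidable (Q p x)] (T : Finset α)
    (hW : ∀ p ∈ P, ∑ x ∈ s.filter (fun x => Q p x), G x ≤ W p)
    (hkey : ∀ x ∈ s, G x * (1 - ∑ p ∈ P, if Q p x then (1 : ℝ) else 0) ≤ if x ∈ T then (1 : ℝ) else 0) :
    ∑ x ∈ s, G x - ∑ p ∈ P, W p ≤ (T.card : ℝ) := by
  have h1 : ∑ p ∈ P, ∑ x ∈ s.filter (fun x => Q p x), G x ≤ ∑ p ∈ P, W p := Finset.sum_le_sum hW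
  have h2 : ∑ p ∈ P, ∑ x ∈ s.filter (fun x => Q p x), G x =
      ∑ x ∈ s, G x * ∑ p ∈ P, (if Q p x then (1 : ℝ) else 0) := by
    simp_rw [Finset.sum_filter, Finset.mul_sum, mul_ite, mul_one, mul_zero]
    exact Finset.sum_comm
  have h3 : ∑ x ∈ s, (if x ∈ T then (1 : ℝ) else 0) ≤ T.card := by
    rw [Finset.sum_boole]
    exact_mod_cast Finset.card_le_card fun x hx => (Finset.mem_filter.1 hx).2
  calc ∑ x ∈ s, G x - ∑ p ∈ P, W p
      ≤ ∑ x ∈ s, G x - ∑ x ∈ s, G x * ∑ p ∈ P, (if Q p x then (1 : ℝ) else 0) := by linarith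
    _ = ∑ x ∈ s, G x * (1 - ∑ p ∈ P, if Q p x then (1 : ℝ) else 0) := by
      rw [← Finset.sum_sub_distrib]
      exact Finset.sum_congr rfl fun x _ => by ring
    _ ≤ ∑ x ∈ s, (if x ∈ T then (1 : ℝ) else 0) := Finset.sum_le_sum hkey
    _ ≤ T.card := h3

/-- Support of a profile below the indicator of `(1/2, 1]`: `f(n / (2K)) ≠ 0` forces `K < n ≤ 2K`. [folklore] -/
theorem lt_and_le_of_ne_zero {f : ℝ → ℝ}
    (hf : ∀ v, 0 ≤ f v ∧ f v ≤ if v ∈ Set.Ioc (1 / 2 : ℝ) 1 then 1 else 0) {K : ℝ} {n : ℕ}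
    (h : f (n / (2 * K)) ≠ 0) : K < n ∧ (n : ℝ) ≤ 2 * K := by
  have hv : (n : ℝ) / (2 * K) ∈ Set.Ioc (1 / 2 : ℝ) 1 := by
    by_contra hv
    have h2 := (hf ((n : ℝ) / (2 * K))).2
    rw [if_neg hv] at h2
    exact h (le_antisymm h2 (hf _).1)
  obtain ⟨hv1, hv2⟩ := hv
  rcases lt_or_ge 0 K with hK | hK
  · have hK2 : (0 : ℝ) < 2 * K := by linarith
    rw [lt_div_iff₀ hK2] at hv1
    rw [div_le_iff₀ hK2, one_mul] at hv2
    exact ⟨by linarith, hv2⟩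
  · have : (n : ℝ) / (2 * K) ≤ 0 := div_nonpos_of_nonneg_of_nonpos (Nat.cast_nonneg n) (by linarith)
    linarith

/-! ### Realness: the parity ternary sum with real profiles as a real double sum -/

/-- For profiles with vanishing imaginary parts, `Re parityTernarySum y 1 d 1 X₁ X₂ X₃` is the real double sum over
odd friable `(n₁, n₂)` of `p₁(n₁/X₁) p₂(n₂/X₂) p₃((d n₁ + n₂)/X₃) · [d n₁ + n₂ ∈ S(X₃, y)]` (the `n₃`-sum collapses).
[folklore] -/
theorem re_parityTernarySum_eq (y d : ℕ) (X₁ X₂ X₃ : ℝ) (c₁ c₂ c₃ : ℤ → ℂ)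
    (h₁ : ∀ v, (profileFn c₁ v).im = 0) (h₂ : ∀ v, (profileFn c₂ v).im = 0)
    (h₃ : ∀ v, (profileFn c₃ v).im = 0) :
    (parityTernarySum y 1 d 1 X₁ X₂ X₃ c₁ c₂ c₃).re =
      ∑ x ∈ ((Nat.smoothNumbersUpTo ⌊X₁⌋₊ (y + 1)).filter (fun n => Odd n)) ×ˢ
          ((Nat.smoothNumbersUpTo ⌊X₂⌋₊ (y + 1)).filter (fun n => Odd n)),
        if d * x.1 + x.2 ∈ Nat.smoothNumbersUpTo ⌊X₃⌋₊ (y + 1) then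
          (profileFn c₁ (x.1 / X₁)).re * (profileFn c₂ (x.2 / X₂)).re *
            (profileFn c₃ ((d * x.1 + x.2 : ℕ) / X₃)).re
        else 0 := by
  unfold parityTernarySum
  rw [Complex.re_sum, Finset.sum_product]
  refine Finset.sum_congr rfl fun n₁ _ => ?_
  rw [Complex.re_sum]
  refine Finset.sum_congr rfl fun n₂ _ => ?_
  rw [Complex.re_sum]
  have hc : ∀ n₃ : ℕ, ((d * n₁ : ℤ) + 1 * ((1 : ℕ) * n₂ : ℤ) = n₃) ↔ d * n₁ + n₂ = n₃ := fun n₃ => by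
    constructor
    · intro h; exact_mod_cast (show ((d * n₁ + n₂ : ℕ) : ℤ) = n₃ by push_cast at h ⊢; linarith)
    · rintro rfl; push_cast; ring
  simp_rw [apply_ite Complex.re, Complex.zero_re, if_congr (hc _) rfl rfl]
  rw [Finset.sum_ite_eq]
  refine if_congr Iff.rfl ?_ rfl
  simp [Complex.mul_re, Complex.mul_im, h₁, h₂, h₃]

/-! ### The `p`-sublattice part of the double sum embeds into the sum at scales `X_i / p` -/

/-- `p n ∈ S(X, y)` implies `n ∈ S(X/p, y)` (`p ≥ 1`). [folklore] -/
theorem mem_smoothNumbersUpTo_div {y p : ℕ} (hp : 0 < p) (X : ℝ) {n : ℕ}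
    (hn : p * n ∈ Nat.smoothNumbersUpTo ⌊X⌋₊ (y + 1)) : n ∈ Nat.smoothNumbersUpTo ⌊X / p⌋₊ (y + 1) := by
  rw [Nat.mem_smoothNumbersUpTo] at hn ⊢
  refine ⟨Nat.le_floor ?_, Nat.mem_smoothNumbers_of_dvd hn.2 (Dvd.intro_left p rfl)⟩
  have h0 : p * n ≠ 0 := Nat.ne_zero_of_mem_smoothNumbers hn.2
  have h1 : ((p * n : ℕ) : ℝ) ≤ X := (Nat.le_floor_iff' h0).1 hn.1
  rw [le_div_iff₀ (by exact_mod_cast hp : (0 : ℝ) < p)]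
  push_cast at h1
  linarith [mul_comm (p : ℝ) n]

/-- SUBLATTICE EMBEDDING: for nonnegative `f_i` and `p ≥ 1`, the part of the real double sum at scales
`(X₁, X₂, X₃)` supported on `p ∣ n₁`, `p ∣ n₂` is at most the double sum at scales `(X₁/p, X₂/p, X₃/p)`
(substitute `n_i = p n_i'`: `p n' ≤ X ⇒ n' ≤ X/p`, divisors of friables are friable, `p n'` odd ⇒ `n'` odd,
and `n'/(X/p) = p n'/X`). [folklore] -/
theorem sum_filter_dvd_le (y d : ℕ) {p : ℕ} (hp : 0 < p) (X₁ X₂ X₃ : ℝ) (f₁ f₂ f₃ : ℝ → ℝ)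
    (h₁ : ∀ v, 0 ≤ f₁ v) (h₂ : ∀ v, 0 ≤ f₂ v) (h₃ : ∀ v, 0 ≤ f₃ v) :
    ∑ x ∈ (((Nat.smoothNumbersUpTo ⌊X₁⌋₊ (y + 1)).filter (fun n => Odd n)) ×ˢ
          ((Nat.smoothNumbersUpTo ⌊X₂⌋₊ (y + 1)).filter (fun n => Odd n))).filter (fun x => p ∣ x.1 ∧ p ∣ x.2),
        (if d * x.1 + x.2 ∈ Nat.smoothNumbersUpTo ⌊X₃⌋₊ (y + 1) then
          f₁ (x.1 / X₁) * f₂ (x.2 / X₂) * f₃ ((d * x.1 + x.2 : ℕ) / X₃) else 0) ≤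
    ∑ x ∈ ((Nat.smoothNumbersUpTo ⌊X₁ / p⌋₊ (y + 1)).filter (fun n => Odd n)) ×ˢ
          ((Nat.smoothNumbersUpTo ⌊X₂ / p⌋₊ (y + 1)).filter (fun n => Odd n)),
        (if d * x.1 + x.2 ∈ Nat.smoothNumbersUpTo ⌊X₃ / p⌋₊ (y + 1) then
          f₁ (x.1 / (X₁ / p)) * f₂ (x.2 / (X₂ / p)) * f₃ ((d * x.1 + x.2 : ℕ) / (X₃ / p)) else 0) := by
  refine sum_le_sum_of_subset_image (fun z : ℕ × ℕ => (p * z.1, p * z.2)) ?_ ?_ ?_ ?_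
  · rintro ⟨a, b⟩ ⟨a', b'⟩ h
    simp only [Prod.mk.injEq] at h
    exact Prod.ext (Nat.eq_of_mul_eq_mul_left hp h.1) (Nat.eq_of_mul_eq_mul_left hp h.2)
  · rintro ⟨m, b⟩ hx
    simp only [Finset.mem_filter, Finset.mem_product] at hx
    obtain ⟨⟨⟨hm, hmo⟩, hb, hbo⟩, ⟨m₁, rfl⟩, b₁, rfl⟩ := hx
    refine Finset.mem_image.2 ⟨(m₁, b₁), ?_, rfl⟩
    simp only [Finset.mem_filter, Finset.mem_product]
    exact ⟨⟨mem_smoothNumbersUpTo_div hp X₁ hm, Nat.Odd.of_mul_right hmo⟩,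
      mem_smoothNumbersUpTo_div hp X₂ hb, Nat.Odd.of_mul_right hbo⟩
  · intro x
    split_ifs
    · exact mul_nonneg (mul_nonneg (h₁ _) (h₂ _)) (h₃ _)
    · exact le_rfl
  · rintro ⟨m₁, b₁⟩ _
    dsimp only
    by_cases hc : d * (p * m₁) + p * b₁ ∈ Nat.smoothNumbersUpTo ⌊X₃⌋₊ (y + 1)
    · have hc' : d * m₁ + b₁ ∈ Nat.smoothNumbersUpTo ⌊X₃ / p⌋₊ (y + 1) :=
        mem_smoothNumbersUpTo_div hp X₃ (by rwa [show p * (d * m₁ + b₁) = d * (p * m₁) + p * b₁ by ring])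
      rw [if_pos hc, if_pos hc']
      have e1 : ((p * m₁ : ℕ) : ℝ) / X₁ = (m₁ : ℝ) / (X₁ / p) := by
        rw [div_div_eq_mul_div]; push_cast; ring
      have e2 : ((p * b₁ : ℕ) : ℝ) / X₂ = (b₁ : ℝ) / (X₂ / p) := by
        rw [div_div_eq_mul_div]; push_cast; ring
      have e3 : ((d * (p * m₁) + p * b₁ : ℕ) : ℝ) / X₃ = ((d * m₁ + b₁ : ℕ) : ℝ) / (X₃ / p) := by
        rw [div_div_eq_mul_div]; push_cast; ring
      rw [e1, e2, e3]
    · rw [if_neg hc]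
      split_ifs
      · exact mul_nonneg (mul_nonneg (h₁ _) (h₂ _)) (h₃ _)
      · exact le_rfl

/-! ### The pointwise Bonferroni inequality -/

/-- POINTWISE BONFERRONI BOUND on an odd friable pair `(m, b)`: with `w = [c ∈ S(4X,y)] p₁(m/2M) p₂(b/2X) p₃(c/4X)`
(`c = 2^N m + b`, `0 ≤ p₁, p₂ ≤ 1_{(1/2,1]}`, `0 ≤ p₃ ≤ 1`),
`w · (1 − Σ_{3 ≤ p ≤ y prime} [p ∣ m][p ∣ b]) ≤ [(m, b) ∈ PairsA]`: if `gcd(m, b) > 1` it has a prime factor,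
odd (`m` odd) and `≤ y` (`m` friable), so the bracket is `≤ 0`; if `gcd(m, b) = 1` and `w ≠ 0` then `M < m ≤ 2M`,
`X < b ≤ 2X`, `gcd(b, 2m) = 1` and `c` is friable, i.e. `(m, b) ∈ PairsA`, while `w ≤ 1`. [folklore] -/
theorem weight_mul_bonferroni_le (N M y : ℕ) (f₁ f₂ f₃ : ℝ → ℝ)
    (h₁ : ∀ v, 0 ≤ f₁ v ∧ f₁ v ≤ if v ∈ Set.Ioc (1 / 2 : ℝ) 1 then 1 else 0)
    (h₂ : ∀ v, 0 ≤ f₂ v ∧ f₂ v ≤ if v ∈ Set.Ioc (1 / 2 : ℝ) 1 then 1 else 0)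
    (h₃ : ∀ v, 0 ≤ f₃ v ∧ f₃ v ≤ 1) {x : ℕ × ℕ}
    (hx : x ∈ ((Nat.smoothNumbersUpTo ⌊(2 * M : ℝ)⌋₊ (y + 1)).filter (fun n => Odd n)) ×ˢ
          ((Nat.smoothNumbersUpTo ⌊(2 * (2 ^ N * M) : ℝ)⌋₊ (y + 1)).filter (fun n => Odd n))) :
    (if 2 ^ N * x.1 + x.2 ∈ Nat.smoothNumbersUpTo ⌊(4 * (2 ^ N * M) : ℝ)⌋₊ (y + 1) then
        f₁ (x.1 / (2 * M : ℝ)) * f₂ (x.2 / (2 * (2 ^ N * M) : ℝ)) *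
          f₃ ((2 ^ N * x.1 + x.2 : ℕ) / (4 * (2 ^ N * M) : ℝ))
      else 0) *
        (1 - ∑ p ∈ (Finset.range (y + 1)).filter (fun p => p.Prime ∧ 3 ≤ p),
          if p ∣ x.1 ∧ p ∣ x.2 then (1 : ℝ) else 0) ≤
      if x ∈ (((friableIoc y M (2 * M)).filter (fun m => Odd m)) ×ˢ
            friableIoc y (2 ^ N * M) (2 * (2 ^ N * M))).filter
          (fun p => Nat.Coprime p.2 (2 * p.1) ∧ 2 ^ N * p.1 + p.2 ∈ Nat.smoothNumbers (y + 1))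
        then (1 : ℝ) else 0 := by
  obtain ⟨m, b⟩ := x
  simp only [Finset.mem_product, Finset.mem_filter, Nat.mem_smoothNumbersUpTo] at hx
  obtain ⟨⟨⟨-, hms⟩, hmo⟩, ⟨-, hbs⟩, hbo⟩ := hx
  dsimp only
  -- the weight is in `[0, 1]`
  have hw0 : 0 ≤ (if 2 ^ N * m + b ∈ Nat.smoothNumbersUpTo ⌊(4 * (2 ^ N * M) : ℝ)⌋₊ (y + 1) then
      f₁ (m / (2 * M : ℝ)) * f₂ (b / (2 * (2 ^ N * M) : ℝ)) * f₃ ((2 ^ N * m + b : ℕ) / (4 * (2 ^ N * M) : ℝ))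
      else 0) := by
    split_ifs
    · exact mul_nonneg (mul_nonneg (h₁ _).1 (h₂ _).1) (h₃ _).1
    · exact le_rfl
  have hf1 : ∀ v, f₁ v ≤ 1 := fun v => (h₁ v).2.trans (by split_ifs <;> norm_num)
  have hf2 : ∀ v, f₂ v ≤ 1 := fun v => (h₂ v).2.trans (by split_ifs <;> norm_num)
  have hw1 : (if 2 ^ N * m + b ∈ Nat.smoothNumbersUpTo ⌊(4 * (2 ^ N * M) : ℝ)⌋₊ (y + 1) then
      f₁ (m / (2 * M : ℝ)) * f₂ (b / (2 * (2 ^ N * M) : ℝ)) * f₃ ((2 ^ N * m + b : ℕ) / (4 * (2 ^ N * M) : ℝ))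
      else 0) ≤ 1 := by
    split_ifs
    · calc f₁ (m / (2 * M : ℝ)) * f₂ (b / (2 * (2 ^ N * M) : ℝ)) * f₃ ((2 ^ N * m + b : ℕ) / (4 * (2 ^ N * M) : ℝ))
          ≤ 1 * 1 * 1 :=
            mul_le_mul (mul_le_mul (hf1 _) (hf2 _) (h₂ _).1 zero_le_one) (h₃ _).2 (h₃ _).1
              (mul_nonneg zero_le_one zero_le_one)
        _ = 1 := by norm_num
    · exact zero_le_one
  have hS0 : 0 ≤ ∑ p ∈ (Finset.range (y + 1)).filter (fun p => p.Prime ∧ 3 ≤ p),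
      (if p ∣ m ∧ p ∣ b then (1 : ℝ) else 0) :=
    Finset.sum_nonneg fun _ _ => by split_ifs <;> norm_num
  by_cases hcop : Nat.Coprime m b
  · -- coprime pair: the bracket is `≤ 1`, and `w ≤ [(m, b) ∈ PairsA]`
    refine le_trans (mul_le_of_le_one_right hw0 (by linarith)) ?_
    split_ifs with hc hmem hmem
    · exact (if_pos hc).symm.le.trans hw1
    · -- `w ≠ 0` would put `(m, b)` in `PairsA`
      by_contra hne
      have hne' : f₁ (m / (2 * M : ℝ)) * f₂ (b / (2 * (2 ^ N * M) : ℝ)) *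
          f₃ ((2 ^ N * m + b : ℕ) / (4 * (2 ^ N * M) : ℝ)) ≠ 0 := fun h0 => hne (h0.le)
      have hne1 : f₁ (m / (2 * M : ℝ)) ≠ 0 := fun h0 => hne' (by rw [h0, zero_mul, zero_mul])
      have hne2 : f₂ (b / (2 * (2 ^ N * M) : ℝ)) ≠ 0 := fun h0 => hne' (by rw [h0, mul_zero, zero_mul])
      obtain ⟨hMm, hm2⟩ := lt_and_le_of_ne_zero h₁ hne1
      obtain ⟨hXb, hb2⟩ := lt_and_le_of_ne_zero h₂ hne2
      refine hmem (Finset.mem_filter.2 ⟨Finset.mem_product.2 ⟨Finset.mem_filter.2 ⟨?_, hmo⟩, ?_⟩,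
        Nat.Coprime.mul_right (Nat.coprime_two_right.2 hbo) hcop.symm, (Nat.mem_smoothNumbersUpTo.1 hc).2⟩)
      · simp only [friableIoc, Finset.mem_filter, Finset.mem_Ioc]
        exact ⟨⟨by exact_mod_cast hMm, by exact_mod_cast hm2⟩, hms⟩
      · simp only [friableIoc, Finset.mem_filter, Finset.mem_Ioc]
        exact ⟨⟨by exact_mod_cast hXb, by exact_mod_cast hb2⟩, hbs⟩
    · exact zero_le_one
    · exact le_rfl
  · -- a common prime factor `q`: odd and `≤ y`, so the bracket is `≤ 0`
    obtain ⟨q, hq, hqd⟩ := Nat.exists_prime_and_dvd hcop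
    have hqm : q ∣ m := hqd.trans (Nat.gcd_dvd_left m b)
    have hqb : q ∣ b := hqd.trans (Nat.gcd_dvd_right m b)
    have hq2 : q ≠ 2 := fun h => hmo.not_two_dvd_nat (h ▸ hqm)
    have hq3 : 3 ≤ q := by have := hq.two_le; omega
    have hqy : q < y + 1 := Nat.mem_smoothNumbers'.1 hms q hq hqm
    have hS1 : (1 : ℝ) ≤ ∑ p ∈ (Finset.range (y + 1)).filter (fun p => p.Prime ∧ 3 ≤ p),
        (if p ∣ m ∧ p ∣ b then (1 : ℝ) else 0) :=
      calc (1 : ℝ) = if q ∣ m ∧ q ∣ b then (1 : ℝ) else 0 := by rw [if_pos ⟨hqm, hqb⟩]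
        _ ≤ _ := Finset.single_le_sum (f := fun p => if p ∣ m ∧ p ∣ b then (1 : ℝ) else 0)
            (fun _ _ => by split_ifs <;> norm_num) (Finset.mem_filter.2 ⟨Finset.mem_range.2 hqy, hq, hq3⟩)
    refine le_trans (mul_nonpos_of_nonneg_of_nonpos hw0 (by linarith)) ?_
    split_ifs <;> norm_num

end BonferroniFABook

open BonferroniFABook

/-- **Registered stub `stub_cardFA_ge_bonferroni`** (line `grh-friable-cell-resolution` of crux stmt-ABC-14354, wave 7):
for `y ≥ 2` and REAL W-class profiles `0 ≤ p₁, p₂ ≤ 1_{(1/2,1]}`, `0 ≤ p₃ ≤ 1`, the Bonferroni combination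
`Re W(2M, 2X, 4X) − Σ_{3 ≤ p ≤ y prime} Re W(2M/p, 2X/p, 4X/p)` of the parity ternary counts
`W(X₁,X₂,X₃) = parityTernarySum y 1 (2^N) 1 X₁ X₂ X₃ c₁ c₂ c₃` (`X = 2^N M`) is at most `#FAfam N M y`:
realness (`re_parityTernarySum_eq`), sublattice embedding (`sum_filter_dvd_le`), the pointwise Bonferroni bound
(`weight_mul_bonferroni_le`), assembly (`sub_sum_le_card`) and `#FAfam = #PairsA` (`card_FAfam`).  (`y ≥ 2` is not
needed.) [folklore] -/
theorem stub_cardFA_ge_bonferroni : ∀ (N M y : ℕ) (c₁ c₂ c₃ : ℤ → ℂ), 2 ≤ y → (∀ v : ℝ, (Literature.NumberTheory.Sieve.SmoothArcs.profileFn c₁ v).im = 0 ∧ 0 ≤ (Literature.NumberTheory.Sieve.SmoothArcs.profileFn c₁ v).re ∧ (Literature.NumberTheory.Sieve.SmoothArcs.profileFn c₁ v).re ≤ (if v ∈ Set.Ioc (1 / 2 : ℝ) 1 then 1 else 0)) → (∀ v : ℝ, (Literature.NumberTheory.Sieve.SmoothArcs.profileFn c₂ v).im = 0 ∧ 0 ≤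 (Literature.NumberTheory.Sieve.SmoothArcs.profileFn c₂ v).re ∧ (Literature.NumberTheory.Sieve.SmoothArcs.profileFn c₂ v).re ≤ (if v ∈ Set.Ioc (1 / 2 : ℝ) 1 then 1 else 0)) → (∀ v : ℝ, (Literature.NumberTheory.Sieve.SmoothArcs.profileFn c₃ v).im = 0 ∧ 0 ≤ (Literature.NumberTheory.Sieve.SmoothArcs.profileFn c₃ v).re ∧ (Literature.NumberTheory.Sieve.SmoothArcs.profileFn c₃ v).re ≤ 1) → (Literature.NumberTheory.Sieve.SmoothArcs.parityTernarySum y 1 (2 ^ N) 1 (2 * M) (2 * (2 ^ N * M)) (4 * (2 ^ N * M)) c₁ c₂ c₃).re - ∑ p ∈ (Finset.range (y + 1)).filter (fun p => p.Prime ∧ 3 ≤ p), (Literature.NumberTheory.Sieve.SmoothArcs.parityTernarySum y 1 (2 ^ N) 1 ((2 * M : ℝ) / p) ((2 * (2 ^ N * M) : ℝ) / p) ((4 * (2 ^ N * M) : ℝ) / p) c₁ c₂ c₃).re ≤ ((FAfam N M y).card : ℝ) := by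
  intro N M y c₁ c₂ c₃ _ h₁ h₂ h₃
  have hre := fun X₁ X₂ X₃ => re_parityTernarySum_eq y (2 ^ N) X₁ X₂ X₃ c₁ c₂ c₃ (fun v => (h₁ v).1)
    (fun v => (h₂ v).1) (fun v => (h₃ v).1)
  simp only [hre]
  rw [card_FAfam]
  refine sub_sum_le_card _ _ _ _ (fun p x => p ∣ x.1 ∧ p ∣ x.2) _ (fun p hp => ?_) (fun x hx => ?_)
  · exact sum_filter_dvd_le y (2 ^ N) (Finset.mem_filter.1 hp).2.1.pos (2 * M) (2 * (2 ^ N * M)) (4 * (2 ^ N * M))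
      (fun v => (profileFn c₁ v).re) (fun v => (profileFn c₂ v).re) (fun v => (profileFn c₃ v).re)
      (fun v => (h₁ v).2.1) (fun v => (h₂ v).2.1) (fun v => (h₃ v).2.1)
  · exact weight_mul_bonferroni_le N M y (fun v => (profileFn c₁ v).re) (fun v => (profileFn c₂ v).re)
      (fun v => (profileFn c₃ v).re) (fun v => (h₁ v).2) (fun v => (h₂ v).2) (fun v => (h₃ v).2) hx

end Summit.ABC.ABC.Theorems.TameLocalReceptacle

end
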